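import Summits.HodgeConjecture.CorCM.OcticWeil13PairFrameTransfer
import Summits.HodgeConjecture.CorCM.OcticWeilMixedSixfoldParts
import HarnessLib

/-!
# COR-CM — two `(1,3)`-types over one octic CM field: the Weil SIXFOLD parts of the `(1,3)`-slot `2` (= `B'₁`, two curve points +
# the four labels of `B'₁` of one sign) have algebraic lines, GIVEN the Weil plane of `(B'₁ × E) × E`

Cell `pub-hodgecm2` (COR-CM), seat b30 gen 21 (2026-08-22); count-neutral own lane OCTIC-WEIL-EIGHTFOLD.  Theorems + one
bookkeeping definition (the fold `fold₂`); no named fact, no `sorry`.  This is `CorCM/OcticWeilMixedSixfoldParts.lean` (seat b30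
gen 20: the sixfold parts of the atom slot `3`) VERBATIM for the atom slot `2`: the atoms are `A₄ = (E, B, B'₁, B'₂)`, the
sixfold parts of `B'₂` (atom slot `3`, model slot `2`) are served by that file BY NAME
(`OcticWeilMixed.weightClassesAlg_le_algebraicClasses_of_isSix₃Part`, definitionally the same part predicate), and the sixfold
parts of `B'₁` (atom slot `2`, model slot `1`) by this one.  The Weil plane of `((B'₁ × E) × E, (ι(iδ) × ι(δ)) × ι(δ))` enters as
the HYPOTHESIS `hW₃` (discharged downstream from `Markman2025_weilClasses_algebraic_hyperbolicSixfold` by gen 18's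
`OcticCurveFourfold.weilClassesOf_le_algebraicClasses_cmFourfold_prod_cmCurve_prod_cmCurve_of_markmanSixfold`).  The device is
gen 18's RE-SLOTTING one dimension up: `slot₅ = (0,1,2,3,0)` (a SECOND curve slot), sub-product `fold₂ = (2, 0, 4)`.

* §1 `fold₂ = (2,0,4)` (the sub-product `B'₁ ⊞ E ⊞ E` of `Y₅ = E ⊞ B ⊞ B'₁ ⊞ B'₂ ⊞ E`);
* §2 `weightClassesAlg_three_le_algebraicClasses_of_sign₂` — a six-point weight of `B'₁ ⊞ E ⊞ E` of constant sign lies in a Weil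
  eigenline, algebraic by `hW₃` transported to `⨁`;
* §3 `weightClassesAlg_le_algebraicClasses_of_isSixfoldPart_one_five` — injective projection to `Y₅` with slots in `{2, 0, 4}`;
* §4 **`weightClassesAlg_le_algebraicClasses_of_isSixfoldPart_one`** — ANY slot map `κ : Fin N → Fin 4`.
HONEST FRAMING: nothing about the Hodge conjecture is concluded here; `HC_CM` is not asserted.
[cite: Deligne1982HodgeCycles, §5 (c)] [cite: vanGeemen1994HodgeAV, 4.9] [cite: Milne2020HodgeClassesAV, 1.2 (a) and Thm. 1]
[cite: MoonenZarhin1995Duke, Thm. 2.4]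

## References
* [Deligne1982HodgeCycles] LNM 900 (1982), §5 (c).  [vanGeemen1994HodgeAV] LNM 1594 (1994), 3.6–3.7, 4.9.
  [Milne2020HodgeClassesAV] arXiv:2010.08857, 1.2 (a), Thm. 1.  [MoonenZarhin1995Duke] Duke Math. J. 77 (1995), Thm. 2.4.
-/

noncomputable section

open CategoryTheory CategoryTheory.Limits NumberField

namespace Summit.HodgeConjecture.CorCM.OcticWeil13Pair

open Literature.AlgebraicGeometry Literature.AlgebraicGeometry.Motives Literature.AlgebraicGeometry.HodgeTheory
open Literature.AlgebraicGeometry.ComplexMultiplication (IsCMTypeRealisation)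
open Literature.AlgebraicGeometry.Pohlmann1968
open Literature.AlgebraicTopology.SingularHomology
open Literature.NumberTheory.ComplexMultiplication
open Summit.HodgeConjecture.CorCM.Census.OcticWeilOrbit (Pt₃)
open Summit.HodgeConjecture.CorCM.Census.OcticWeil13Pair (IsSixfoldPart)
open Summit.HodgeConjecture.CorCM.OcticWeilOrbit (orbitSlots toPt₃ toPt₃_zero toPt₃_succ sigma_cases₃)
open Summit.HodgeConjecture.CorCM.OcticWeilMixed (slot₅ slot₅_castSucc apply_eq_of_sign fst_eq_zero_of_toPt₃_eq_inl)
open Summit.HodgeConjecture.CorCM.OcticCurveFourfold (weilClassesOf_biproduct₃_le_algebraicClasses_of_prod)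
open Summit.HodgeConjecture.CorCM.CMWeights (weightClassesAlg_comp_le_algebraicClasses_of_injOn
  weightClassesAlg_map_le_algebraicClasses sigma_map_injective)
open Summit.HodgeConjecture.CorCM.PairWeights

open scoped Classical

/-! ## §1 The fold -/

/-- The three-factor sub-product `(2, 0, 4)` of `Y₅ = E ⊞ B ⊞ B'₁ ⊞ B'₂ ⊞ E`: `B'₁ ⊞ E ⊞ E`. [folklore] -/
def fold₂ : Fin 3 → Fin 5 := ![2, 0, 4]

/-- `fold₂` is injective. [folklore] -/
theorem fold₂_injective : Function.Injective fold₂ := by unfold fold₂; decide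

/-- The range of `fold₂` is `{2, 0, 4}`. [folklore] -/
theorem mem_range_fold₂ {l : Fin 5} (h : l = 2 ∨ l = 0 ∨ l = 4) : l ∈ Set.range fold₂ := by
  rcases h with rfl | rfl | rfl; exacts [⟨0, rfl⟩, ⟨1, rfl⟩, ⟨2, rfl⟩]

section Sixfold

variable {I : Type} {Kf : I → Type} [∀ i, Field (Kf i)] [∀ i, NumberField (Kf i)]
  {i₀ i₁ : I} {e : (Kf i₁ →+* ℂ) ≃ Fin 4 × Bool} {τ : Kf i₀ →+* ℂ} {i : Kf i₀ →+* Kf i₁}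
  (hk : ∀ σ : Kf i₀ →+* ℂ, σ = τ ∨ σ = ComplexEmbedding.conjugate τ)
  (he_sign : ∀ s : Kf i₁ →+* ℂ, (e s).2 = true ↔ s.comp i = τ)
  {A₄ : Fin 4 → AbelianVariety ℂ} {Φ₄ : ∀ j : Fin 4, CMType (Kf (orbitSlots i₀ i₁ j))}
  {ι₄ : ∀ j, 𝓞 (Kf (orbitSlots i₀ i₁ j)) →+* End (A₄ j)}
  {θ₄ : ∀ j, Kf (orbitSlots i₀ i₁ j) →+* Module.End ℂ (complexBetti (A₄ j).X 1)}
  (hA : ∀ j, IsCMTypeRealisation (Φ₄ j) (A₄ j) (ι₄ j) (θ₄ j))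
  {δ : 𝓞 (Kf i₀)} {d : ℕ} (hτ : τ (δ : Kf i₀) = Complex.I * (Real.sqrt d : ℂ))

/-! ## §2 A six-point weight of `B' ⊞ E ⊞ E` of constant sign is algebraic, given the Weil plane -/

omit [∀ i, NumberField (Kf i)] in
include hk he_sign hτ in
/-- **A six-point weight of `Y₃ = B' ⊞ E ⊞ E` (the sub-product `fold₂` of `Y₅`) of constant sign has an algebraic line, GIVEN
the Weil plane of the sixfold.**  All six points have eigenvalue `±i√d` on `(iδ, δ, δ)`, so the line lies in a Weil eigenline
(`PairWeights.weightClassesAlg_le_weilClassesPlus/Minus`) `⊆ W ⊗ ℂ`, algebraic by `hW₃` transported to `⨁`.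
[cite: vanGeemen1994HodgeAV, 4.9] [cite: Deligne1982HodgeCycles, §5 (c)] -/
theorem weightClassesAlg_three_le_algebraicClasses_of_sign₂
    (hW₃ : weilClassesOf (((A₄ 2).prod (A₄ 0)).prod (A₄ 0))
      (AbelianVariety.prodLift
        (AbelianVariety.fst ((A₄ 2).prod (A₄ 0)) (A₄ 0) ≫
          AbelianVariety.prodLift (AbelianVariety.fst (A₄ 2) (A₄ 0) ≫ ι₄ 2 (RingOfIntegers.mapRingHom i δ))
            (AbelianVariety.snd (A₄ 2) (A₄ 0) ≫ ι₄ 0 δ))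
        (AbelianVariety.snd ((A₄ 2).prod (A₄ 0)) (A₄ 0) ≫ ι₄ 0 δ)) 3 d ≤
      algebraicClasses (((A₄ 2).prod (A₄ 0)).prod (A₄ 0)).X 3)
    (b : Bool) (T : Finset ((m : Fin 3) × (Kf (orbitSlots i₀ i₁ (slot₅ (fold₂ m))) →+* ℂ))) (hTcard : T.card = 2 * 3)
    (hsgn : ∀ z ∈ T, toPt₃ e τ ⟨slot₅ (fold₂ z.1), z.2⟩ = Sum.inl b ∨
      ∃ (m : Fin 3) (a : Fin 4), toPt₃ e τ ⟨slot₅ (fold₂ z.1), z.2⟩ = Sum.inr (m, (a, b))) :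
    weightClassesAlg (fun m => A₄ (slot₅ (fold₂ m))) (fun m => ι₄ (slot₅ (fold₂ m))) (2 * 3) T ≤
      algebraicClasses (⨁ fun m => A₄ (slot₅ (fold₂ m))).X 3 := by
  -- the family `(iδ, δ, δ)` on the three slots, as the restriction of `a₄ = (δ, iδ, iδ, iδ)`
  let a₄ : ∀ l : Fin 4, 𝓞 (Kf (orbitSlots i₀ i₁ l)) := Fin.cons δ fun _ : Fin 3 => RingOfIntegers.mapRingHom i δ
  let a₃ : ∀ m : Fin 3, 𝓞 (Kf (orbitSlots i₀ i₁ (slot₅ (fold₂ m)))) := fun m => a₄ (slot₅ (fold₂ m))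
  have hval : ∀ z ∈ T, z.2 ((a₃ z.1 : 𝓞 (Kf (orbitSlots i₀ i₁ (slot₅ (fold₂ z.1))))) :
      Kf (orbitSlots i₀ i₁ (slot₅ (fold₂ z.1)))) = if b then Complex.I * (Real.sqrt d : ℂ) else -(Complex.I * (Real.sqrt d : ℂ)) :=
    fun z hz => apply_eq_of_sign hk he_sign hτ ⟨slot₅ (fold₂ z.1), z.2⟩ b (hsgn z hz)
  -- the Weil plane of `⨁_m A₄(slot₅ (fold₂ m))`, algebraic by `hW₃`
  have hWeil : weilClassesOf (⨁ fun m => A₄ (slot₅ (fold₂ m))) (biproduct.map fun m => ι₄ (slot₅ (fold₂ m)) (a₃ m)) 3 d ≤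
      algebraicClasses (⨁ fun m => A₄ (slot₅ (fold₂ m))).X 3 :=
    weilClassesOf_biproduct₃_le_algebraicClasses_of_prod (A := fun m => A₄ (slot₅ (fold₂ m)))
      (fun m => ι₄ (slot₅ (fold₂ m)) (a₃ m)) hW₃
  cases b
  · refine (weightClassesAlg_le_weilClassesMinus (K := fun m => Kf (orbitSlots i₀ i₁ (slot₅ (fold₂ m))))
      (A := fun m => A₄ (slot₅ (fold₂ m))) (ι := fun m => ι₄ (slot₅ (fold₂ m))) a₃ hTcard fun z hz => ?_).trans
      ((weilClassesMinus_le_weilClassesOf _ _ 3 d).trans hWeil)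
    simpa using hval z hz
  · refine (weightClassesAlg_le_weilClassesPlus (K := fun m => Kf (orbitSlots i₀ i₁ (slot₅ (fold₂ m))))
      (A := fun m => A₄ (slot₅ (fold₂ m))) (ι := fun m => ι₄ (slot₅ (fold₂ m))) a₃ hTcard fun z hz => ?_).trans
      ((weilClassesPlus_le_weilClassesOf _ _ 3 d).trans hWeil)
    simpa using hval z hz

/-! ## §3 Sixfold parts of `⨁_j A₄(slot₅ (κ₅ j))` with injective projection to `Y₅` -/

include hk he_sign hA hτ in
/-- **Re-slotted form.**  For `κ₅ : Fin N → Fin 5`, a sixfold part `G` of a weight of `X = ⨁_j A₄(slot₅ (κ₅ j))` on which the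
projection `P₅ (j, s) = (κ₅ j, s)` to `Y₅` is injective and takes slots in `{3, 0, 4}` has an algebraic line: `P₅(G)` is the
image under `fold₂` of a six-point weight of `B' ⊞ E ⊞ E` of constant sign (§2), pulled back to `Y₅`
(`CMWeights.weightClassesAlg_map_le_algebraicClasses`) and lifted along `κ₅` (distribution lemma).
[cite: Milne2020HodgeClassesAV, 1.2 (a) and Thm. 1] -/
theorem weightClassesAlg_le_algebraicClasses_of_isSixfoldPart_one_five
    (hW₃ : weilClassesOf (((A₄ 2).prod (A₄ 0)).prod (A₄ 0))
      (AbelianVariety.prodLift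
        (AbelianVariety.fst ((A₄ 2).prod (A₄ 0)) (A₄ 0) ≫
          AbelianVariety.prodLift (AbelianVariety.fst (A₄ 2) (A₄ 0) ≫ ι₄ 2 (RingOfIntegers.mapRingHom i δ))
            (AbelianVariety.snd (A₄ 2) (A₄ 0) ≫ ι₄ 0 δ))
        (AbelianVariety.snd ((A₄ 2).prod (A₄ 0)) (A₄ 0) ≫ ι₄ 0 δ)) 3 d ≤
      algebraicClasses (((A₄ 2).prod (A₄ 0)).prod (A₄ 0)).X 3)
    {N : ℕ} (κ₅ : Fin N → Fin 5) {b : Bool} {G : Finset ((j : Fin N) × (Kf (orbitSlots i₀ i₁ (slot₅ (κ₅ j))) →+* ℂ))}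
    (hG : IsSixfoldPart (fun x => toPt₃ e τ ⟨slot₅ (κ₅ x.1), x.2⟩) 1 b G)
    (hinj : Set.InjOn (Sigma.map κ₅ (fun _ => id) :
      ((j : Fin N) × (Kf (orbitSlots i₀ i₁ (slot₅ (κ₅ j))) →+* ℂ)) →
        ((l : Fin 5) × (Kf (orbitSlots i₀ i₁ (slot₅ l)) →+* ℂ))) ↑G)
    (hrange : ∀ x ∈ G, κ₅ x.1 ∈ Set.range fold₂) :
    weightClassesAlg (fun j => A₄ (slot₅ (κ₅ j))) (fun j => ι₄ (slot₅ (κ₅ j))) (2 * 3) G ≤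
      algebraicClasses (⨁ fun j => A₄ (slot₅ (κ₅ j))).X 3 := by
  set P₅ : ((j : Fin N) × (Kf (orbitSlots i₀ i₁ (slot₅ (κ₅ j))) →+* ℂ)) →
      ((l : Fin 5) × (Kf (orbitSlots i₀ i₁ (slot₅ l)) →+* ℂ)) := Sigma.map κ₅ (fun _ => id) with hP₅
  set T₅ := G.image P₅ with hT₅
  have hT₅card : T₅.card = 2 * 3 := by rw [hT₅, Finset.card_image_of_injOn hinj, hG.1]
  -- the sub-product weight
  set F₃ : ((m : Fin 3) × (Kf (orbitSlots i₀ i₁ (slot₅ (fold₂ m))) →+* ℂ)) →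
      ((l : Fin 5) × (Kf (orbitSlots i₀ i₁ (slot₅ l)) →+* ℂ)) := fun z => ⟨fold₂ z.1, z.2⟩ with hF₃
  have hF₃inj : Function.Injective F₃ :=
    sigma_map_injective (K := fun l => Kf (orbitSlots i₀ i₁ (slot₅ l))) fold₂ fold₂_injective
  set T₃ := T₅.preimage F₃ hF₃inj.injOn with hT₃
  have hT₃map : T₃.map ⟨F₃, hF₃inj⟩ = T₅ := by
    rw [Finset.map_eq_image, hT₃]
    change (T₅.preimage F₃ hF₃inj.injOn).image F₃ = T₅
    rw [Finset.image_preimage]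
    have key : ∀ y : (l : Fin 5) × (Kf (orbitSlots i₀ i₁ (slot₅ l)) →+* ℂ), y.1 ∈ Set.range fold₂ → y ∈ Set.range F₃ := by
      rintro ⟨l, t⟩ ⟨m, rfl⟩
      exact ⟨⟨m, t⟩, rfl⟩
    refine Finset.filter_true_of_mem fun y hy => ?_
    obtain ⟨x, hx, rfl⟩ := Finset.mem_image.1 hy
    exact key (P₅ x) (hrange x hx)
  have hT₃card : T₃.card = 2 * 3 := by rw [← hT₅card, ← hT₃map, Finset.card_map]
  have hsgn : ∀ z ∈ T₃, toPt₃ e τ ⟨slot₅ (fold₂ z.1), z.2⟩ = Sum.inl b ∨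
      ∃ (m : Fin 3) (a : Fin 4), toPt₃ e τ ⟨slot₅ (fold₂ z.1), z.2⟩ = Sum.inr (m, (a, b)) := by
    intro z hz
    have hz' : F₃ z ∈ T₅ := Finset.mem_preimage.1 hz
    obtain ⟨x, hx, hxz⟩ := Finset.mem_image.1 hz'
    have hv : toPt₃ e τ ⟨slot₅ (κ₅ x.1), x.2⟩ = toPt₃ e τ ⟨slot₅ (fold₂ z.1), z.2⟩ :=
      congrArg (fun w : (l : Fin 5) × (Kf (orbitSlots i₀ i₁ (slot₅ l)) →+* ℂ) =>
        toPt₃ e τ (⟨slot₅ w.1, w.2⟩ : (l : Fin 4) × (Kf (orbitSlots i₀ i₁ l) →+* ℂ))) hxz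
    rw [← hv]
    rcases hG.mem_cases hx with h | ⟨a, h⟩
    · exact Or.inl h
    · exact Or.inr ⟨1, a, h⟩
  have halg₃ := weightClassesAlg_three_le_algebraicClasses_of_sign₂ hk he_sign hτ hW₃ b T₃ hT₃card hsgn
  -- pull back to `Y₅` and lift along `κ₅`
  have hA₅ : ∀ l : Fin 5, IsCMTypeRealisation (Φ₄ (slot₅ l)) (A₄ (slot₅ l)) (ι₄ (slot₅ l)) (θ₄ (slot₅ l)) :=
    fun l => hA (slot₅ l)
  have hY₅ := weightClassesAlg_map_le_algebraicClasses (K := fun l => Kf (orbitSlots i₀ i₁ (slot₅ l)))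
    (A := fun l => A₄ (slot₅ l)) (Φ := fun l => Φ₄ (slot₅ l)) (ι := fun l => ι₄ (slot₅ l)) (θ := fun l => θ₄ (slot₅ l))
    hA₅ fold₂ fold₂_injective hT₃card halg₃
  rw [hT₃map] at hY₅
  exact weightClassesAlg_comp_le_algebraicClasses_of_injOn (K := fun l => Kf (orbitSlots i₀ i₁ (slot₅ l)))
    (A := fun l => A₄ (slot₅ l)) (Φ := fun l => Φ₄ (slot₅ l)) (ι := fun l => ι₄ (slot₅ l)) (θ := fun l => θ₄ (slot₅ l))
    hA₅ κ₅ hG.1 hinj hY₅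

/-! ## §4 Any slot map: re-slot the second curve copy -/

include hk he_sign hA hτ in
/-- **Re-slotting.**  For `κ : Fin N → Fin 4` FACTORED as `κ = slot₅ ∘ κ₅` (so that `X = ⨁_j A₄(κ j)` is LITERALLY
`⨁_j A₄(slot₅ (κ₅ j))`), a sixfold part `G` of a weight of `X` whose two curve points are SEPARATED by `κ₅` and whose slots
under `κ₅` lie in `{3, 0, 4}` has an algebraic line (§3; injectivity of the projection from `IsSixfoldPart.eq_of_inr`).
[cite: Milne2020HodgeClassesAV, 1.2 (a) and Thm. 1] -/
theorem weightClassesAlg_le_algebraicClasses_of_isSixfoldPart_one_of_factor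
    (hW₃ : weilClassesOf (((A₄ 2).prod (A₄ 0)).prod (A₄ 0))
      (AbelianVariety.prodLift
        (AbelianVariety.fst ((A₄ 2).prod (A₄ 0)) (A₄ 0) ≫
          AbelianVariety.prodLift (AbelianVariety.fst (A₄ 2) (A₄ 0) ≫ ι₄ 2 (RingOfIntegers.mapRingHom i δ))
            (AbelianVariety.snd (A₄ 2) (A₄ 0) ≫ ι₄ 0 δ))
        (AbelianVariety.snd ((A₄ 2).prod (A₄ 0)) (A₄ 0) ≫ ι₄ 0 δ)) 3 d ≤
      algebraicClasses (((A₄ 2).prod (A₄ 0)).prod (A₄ 0)).X 3)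
    {N : ℕ} (κ : Fin N → Fin 4) (κ₅ : Fin N → Fin 5) (hκ : ∀ j, slot₅ (κ₅ j) = κ j)
    {b : Bool} {G : Finset ((j : Fin N) × (Kf (orbitSlots i₀ i₁ (κ j)) →+* ℂ))}
    (hG : IsSixfoldPart (fun x => toPt₃ e τ ((Sigma.map κ (fun _ => id) :
      ((j : Fin N) × (Kf (orbitSlots i₀ i₁ (κ j)) →+* ℂ)) → ((l : Fin 4) × (Kf (orbitSlots i₀ i₁ l) →+* ℂ))) x)) 1 b G)
    (hsep : ∀ x ∈ G, ∀ x' ∈ G, toPt₃ e τ ⟨κ x.1, x.2⟩ = Sum.inl b → toPt₃ e τ ⟨κ x'.1, x'.2⟩ = Sum.inl b → x ≠ x' →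
      κ₅ x.1 ≠ κ₅ x'.1)
    (hrange : ∀ x ∈ G, κ₅ x.1 ∈ Set.range fold₂) :
    weightClassesAlg (fun j => A₄ (κ j)) (fun j => ι₄ (κ j)) (2 * 3) G ≤ algebraicClasses (⨁ fun j => A₄ (κ j)).X 3 := by
  -- `X` is literally the re-slotted product
  obtain rfl : κ = fun j => slot₅ (κ₅ j) := funext fun j => (hκ j).symm
  refine weightClassesAlg_le_algebraicClasses_of_isSixfoldPart_one_five hk he_sign hA hτ hW₃ κ₅ hG ?_ hrange
  -- injectivity of the projection on `G`
  intro x hx x' hx' hxx'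
  have hfst : κ₅ x.1 = κ₅ x'.1 := congrArg Sigma.fst hxx'
  have hvv : toPt₃ e τ ⟨slot₅ (κ₅ x.1), x.2⟩ = toPt₃ e τ ⟨slot₅ (κ₅ x'.1), x'.2⟩ := by
    have h := congrArg (fun z : (l : Fin 5) × (Kf (orbitSlots i₀ i₁ (slot₅ l)) →+* ℂ) =>
      toPt₃ e τ (⟨slot₅ z.1, z.2⟩ : (l : Fin 4) × (Kf (orbitSlots i₀ i₁ l) →+* ℂ))) hxx'
    exact h
  by_contra hne
  rcases hy : toPt₃ e τ ⟨slot₅ (κ₅ x.1), x.2⟩ with c | q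
  · have hc : c = b := by
      rcases hG.mem_cases hx with h | ⟨a, h⟩
      · change toPt₃ e τ ⟨slot₅ (κ₅ x.1), x.2⟩ = _ at h; rw [hy] at h; exact Sum.inl.inj h
      · change toPt₃ e τ ⟨slot₅ (κ₅ x.1), x.2⟩ = _ at h; rw [hy] at h; exact absurd h Sum.inl_ne_inr
    subst hc
    rw [hy] at hvv
    exact hsep x hx x' hx' hy hvv.symm hne hfst
  · rw [hy] at hvv
    exact hne (hG.eq_of_inr hx hx' hy hvv.symm)

include hk he_sign hA hτ in
/-- **THE SIXFOLD PARTS HAVE ALGEBRAIC LINES (any slot map).**  For `κ : Fin N → Fin 4` and a sixfold part `G` (sign `b`) of a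
weight of `X = ⨁_j A₄(κ j)` — two curve points `x₁ ≠ x₂` over `inl b` (two different copies of `E`) and the four labels of `B'`
of sign `b` — `H⁶(X)_G ⊆ N³ H⁶(X)`, GIVEN the Weil plane of `(B' × E) × E`.  Re-slot: `κ₅ j₂ = 4`, `κ₅ j = κ j ↪ Fin 5`
otherwise (`slot₅ ∘ κ₅ = κ`; `κ₅ j₁ = 0 ≠ 4` separates the curve points; the `B'`-points keep slot `3`), then the factored
form. [cite: Milne2020HodgeClassesAV, 1.2 (a) and Thm. 1] [cite: Deligne1982HodgeCycles, §5 (c)] -/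
theorem weightClassesAlg_le_algebraicClasses_of_isSixfoldPart_one
    (hW₃ : weilClassesOf (((A₄ 2).prod (A₄ 0)).prod (A₄ 0))
      (AbelianVariety.prodLift
        (AbelianVariety.fst ((A₄ 2).prod (A₄ 0)) (A₄ 0) ≫
          AbelianVariety.prodLift (AbelianVariety.fst (A₄ 2) (A₄ 0) ≫ ι₄ 2 (RingOfIntegers.mapRingHom i δ))
            (AbelianVariety.snd (A₄ 2) (A₄ 0) ≫ ι₄ 0 δ))
        (AbelianVariety.snd ((A₄ 2).prod (A₄ 0)) (A₄ 0) ≫ ι₄ 0 δ)) 3 d ≤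
      algebraicClasses (((A₄ 2).prod (A₄ 0)).prod (A₄ 0)).X 3)
    {N : ℕ} (κ : Fin N → Fin 4) {b : Bool} {G : Finset ((j : Fin N) × (Kf (orbitSlots i₀ i₁ (κ j)) →+* ℂ))}
    (hG : IsSixfoldPart (fun x => toPt₃ e τ ((Sigma.map κ (fun _ => id) :
      ((j : Fin N) × (Kf (orbitSlots i₀ i₁ (κ j)) →+* ℂ)) → ((l : Fin 4) × (Kf (orbitSlots i₀ i₁ l) →+* ℂ))) x)) 1 b G) :
    G.card = 2 * 3 ∧ weightClassesAlg (fun j => A₄ (κ j)) (fun j => ι₄ (κ j)) (2 * 3) G ≤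
      algebraicClasses (⨁ fun j => A₄ (κ j)).X 3 := by
  refine ⟨hG.1, ?_⟩
  -- the two curve points, in two different copies
  obtain ⟨x₁, hx₁, x₂, hx₂, hne, hv₁, hv₂⟩ := hG.exists_pair
  obtain ⟨σ₁, hσ₁, hσ₁'⟩ := fst_eq_zero_of_toPt₃_eq_inl hk (x := ⟨κ x₁.1, x₁.2⟩) hv₁
  obtain ⟨σ₂, hσ₂, hσ₂'⟩ := fst_eq_zero_of_toPt₃_eq_inl hk (x := ⟨κ x₂.1, x₂.2⟩) hv₂
  have hκ₁ : κ x₁.1 = 0 := congrArg Sigma.fst hσ₁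
  have hκ₂ : κ x₂.1 = 0 := congrArg Sigma.fst hσ₂
  have hj : x₁.1 ≠ x₂.1 := by
    intro hj
    apply hne
    have h1 : (⟨κ x₁.1, x₁.2⟩ : (l : Fin 4) × (Kf (orbitSlots i₀ i₁ l) →+* ℂ)) = ⟨κ x₂.1, x₂.2⟩ := by
      rw [hσ₁, hσ₂, hσ₁', hσ₂']
    obtain ⟨j₁, s₁⟩ := x₁
    obtain ⟨j₂, s₂⟩ := x₂
    change j₁ = j₂ at hj
    subst hj
    simp only [Sigma.mk.injEq, heq_eq_eq, true_and] at h1 ⊢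
    exact h1
  -- the curve points of `G` are exactly `x₁`, `x₂`
  have hmem : ∀ y ∈ G, toPt₃ e τ ⟨κ y.1, y.2⟩ = Sum.inl b → y = x₁ ∨ y = x₂ := by
    intro y hy' hyv
    obtain ⟨z₁, z₂, -, h12⟩ := Finset.card_eq_two.1 hG.2.1
    have hall : ∀ y ∈ G, toPt₃ e τ ⟨κ y.1, y.2⟩ = Sum.inl b → y = z₁ ∨ y = z₂ := by
      intro y hy'' hyv'
      have : y ∈ G.filter fun x => toPt₃ e τ ((Sigma.map κ (fun _ => id) :
          ((j : Fin N) × (Kf (orbitSlots i₀ i₁ (κ j)) →+* ℂ)) → ((l : Fin 4) × (Kf (orbitSlots i₀ i₁ l) →+* ℂ))) x) =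
            Sum.inl b := Finset.mem_filter.2 ⟨hy'', hyv'⟩
      rw [h12, Finset.mem_insert, Finset.mem_singleton] at this
      exact this
    rcases hall x₁ hx₁ hv₁ with h₁ | h₁ <;> rcases hall x₂ hx₂ hv₂ with h₂ | h₂
    · exact absurd (h₁.trans h₂.symm) hne
    · rcases hall y hy' hyv with h | h
      · exact Or.inl (h.trans h₁.symm)
      · exact Or.inr (h.trans h₂.symm)
    · rcases hall y hy' hyv with h | h
      · exact Or.inr (h.trans h₂.symm)
      · exact Or.inl (h.trans h₁.symm)
    · exact absurd (h₁.trans h₂.symm) hne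
  -- the re-slotting `κ₅`
  let κ₅ : Fin N → Fin 5 := fun j => if j = x₂.1 then 4 else Fin.castSucc (κ j)
  have hκ₅ : ∀ j, slot₅ (κ₅ j) = κ j := by
    intro j
    by_cases h : j = x₂.1
    · simp only [κ₅, if_pos h]; rw [h, hκ₂]; rfl
    · simp only [κ₅, if_neg h]; exact slot₅_castSucc (κ j)
  have hκ₅₂ : κ₅ x₂.1 = 4 := by simp only [κ₅, if_pos rfl]
  have hκ₅₁ : κ₅ x₁.1 = 0 := by simp only [κ₅, if_neg hj]; rw [hκ₁]; rfl
  refine weightClassesAlg_le_algebraicClasses_of_isSixfoldPart_one_of_factor hk he_sign hA hτ hW₃ κ κ₅ hκ₅ hG ?_ ?_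
  · -- separation of the curve points
    intro x hx x' hx' hxv hx'v hxx' hfst
    rcases hmem x hx hxv with rfl | rfl <;> rcases hmem x' hx' hx'v with rfl | rfl
    · exact hxx' rfl
    · rw [hκ₅₁, hκ₅₂] at hfst; exact absurd hfst (by decide)
    · rw [hκ₅₁, hκ₅₂] at hfst; exact absurd hfst (by decide)
    · exact hxx' rfl
  · -- slots in `{3, 0, 4}`
    intro x hx
    refine mem_range_fold₂ ?_
    rcases hG.mem_cases hx with h | ⟨a, h⟩
    · rcases hmem x hx h with rfl | rfl
      · exact Or.inr (Or.inl hκ₅₁)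
      · exact Or.inr (Or.inr hκ₅₂)
    · -- a `B'₁` point: slot `2`, in a copy different from `x₂`
      change toPt₃ e τ ⟨κ x.1, x.2⟩ = _ at h
      have hx3 : κ x.1 = 2 := by
        rcases sigma_cases₃ (⟨κ x.1, x.2⟩ : (l : Fin 4) × (Kf (orbitSlots i₀ i₁ l) →+* ℂ)) with ⟨σ, hσ⟩ | ⟨m, s, hs⟩
        · rw [hσ, toPt₃_zero] at h; exact absurd h Sum.inl_ne_inr
        · rw [hs, toPt₃_succ, Sum.inr.injEq, Prod.mk.injEq] at h
          have hm : m = 1 := h.1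
          have h1 := congrArg Sigma.fst hs
          change κ x.1 = m.succ at h1
          rw [h1, hm]; rfl
      have hne₂ : x.1 ≠ x₂.1 := by
        intro hh
        rw [hh, hκ₂] at hx3
        exact absurd hx3 (by decide)
      left
      show κ₅ x.1 = 2
      simp only [κ₅, if_neg hne₂, hx3]
      rfl

end Sixfold

end Summit.HodgeConjecture.CorCM.OcticWeil13Pair

end
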